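import Mathlib.FieldTheory.IntermediateField.Adjoin.Basic
import Mathlib.RingTheory.AlgebraicIndependent.TranscendenceBasis
import Mathlib.Order.Filter.FilterProduct
import Mathlib.ModelTheory.Ultraproducts
import Mathlib.Algebra.Polynomial.Roots
import Mathlib.Analysis.SpecialFunctions.Complex.Log
import Literature.ModelTheory.ExponentialFields.ExponentialField
import Literature.NumberTheory.Transcendental.ZilberField
import Literature.NumberTheory.Transcendental.SchanuelEclEmptyProofs
import HarnessLib
import HarnessLib.Audit

/-!
# Barrier (Schanuel): the Schanuel property is not first-order — it fails in every ultrapower of `ℂ_exp` (Kirby–Zilber), so the "Strong Schanuel Conjecture" is false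

`Literature/Barriers/Schanuel/SchanuelPropertyNotFirstOrder.lean` — barrier catalogue entry
(D-0021) for the summit `Schanuel` (`Summits/Schanuel/Schanuel/Statement.lean`; the summit is
`Literature.SchanuelProperty ℂ` by `Iff.rfl`), seed "o-minimality / Ax–Schanuel gives functional not
numerical statements" (model-theoretic half: what first-order transfer can and cannot carry).
Everything is PROVED. Kirby–Zilber (§2.1 "Failure of the Schanuel property") observe that the
Schanuel property — axiom 3 of Zilber's `ℂ_exp`-axioms, which for `ℂ` IS Schanuel's conjecture —
"is not" expressible as a first-order axiom scheme: in any exponential field whose kernel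
stabiliser `Z(F)` contains a transcendental `r`, the kernel elements `rⁿt` are `ℚ`-linearly
independent "but of transcendence degree only 2". We prove this for every exponential field
(`not_schanuelProperty_of_transcendental_kernelMultiplier`), construct the ultrapower
`F^ℕ/𝒰` of an arbitrary exponential field of characteristic zero as an exponential field
(`Ultrapower F`, Mathlib's `Filter.Germ` over the hyperfilter), prove Łoś's theorem for it in the
language `(+, ·, −, 0, 1, exp)` (`ultrapower_elementarilyEquivalent`, from Mathlib's
`FirstOrder.Language.Ultraproduct.sentence_realize`), and deduce: the ultrapower of `ℂ_exp` is
elementarily equivalent to `ℂ_exp` and violates the Schanuel property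
(`not_schanuelProperty_ultrapower_complex`). Hence Kirby's "Strong Schanuel Conjecture" (SSC) —
"(SC) holds for all ultrapowers of `ℂ_exp` … Equivalently, (SC) is true of `ℂ_exp` and is part
of its first order theory" — is FALSE (`not_strongSchanuelConjecture`), as Kirby records ("The
conjecture (SSC) is false. See [ECFCIT]"); if Schanuel's conjecture holds, the Schanuel property
is not even invariant under elementary equivalence (`schanuelProperty_not_elementary_of_schanuel`),
and, given one Zilber field (tree fact `Literature.NumberTheory.Transcendental.exists_isZilberField_of_aleph0_lt`), no first-order
theory in this language axiomatises the exponential fields with the Schanuel property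
(`not_axiomatisable_of_exists_isZilberField`).

## What the sources print (verified on the page)

* Kirby–Zilber, Ann. Pure Appl. Logic 165 (2014) = arXiv:1108.1075 [KirbyZilber2014], §1:
  Zilber's axioms 1 (ELA-field), 2 (Standard kernel), 3 ("Schanuel Property The predimension
  function `δ(x̄) := td(x̄, exp(x̄)) − ldim_ℚ(x̄)` satisfies `δ(x̄) ≥ 0` for all tuples `x̄` from
  `F`"), 4 (SEAC), 5 (CCP); "The axioms are not all first-order, but can all be expressed in the
  logic `L_{ω₁,ω}(Q)`"; "Define `Z(F) = {r ∈ F | ∀x[x ∈ ker → rx ∈ ker]}`, the multiplicative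
  stabilizer of the kernel. In any ELA-field `F` with standard kernel, `Z(F)` will actually be
  `ℤ`"; Outline: "In §2, we explain why the Schanuel property is not first-order expressible,
  introduce the strong kernel property, and show that it is first-order expressible iff CIT is
  true."
* ibid. §2.1 "Failure of the Schanuel property": "It is clear that axioms 1 and 2′ are
  expressible as first-order axioms schemes. However axiom 3, the Schanuel property, is not. To
  see this, suppose `F` satisfies the Schanuel property and `k₁, …, kₙ ∈ ker(F)` are `ℚ`-linearly
  independent. Then `td(k₁, …, kₙ, 1, …, 1) = n`, so `k₁, …, kₙ` are algebraically independent.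
  This is a strong structural property, but it is not true in any elementary extension `F` of
  `B_{ℵ₀}` with non-standard kernel. To see this, suppose `r ∈ Z(F)` is transcendental. Then
  `{rⁿ | n ∈ ℕ}` is `ℚ`-linearly independent, and it lies in `Z(F)` since `Z(F)` is a subring of
  `F`. So for any `t ∈ ker(F)`, `{rⁿt | n ∈ ℕ}` lies in `ker(F)` and is `ℚ`-linearly
  independent, is but of transcendence degree only 2."; §2.2–2.6: the replacement axiom 3′
  "strong kernel" `Δ_F(x̄) = td(x̄, exp(x̄)/ker(F)) − ldim_ℚ(x̄/ker(F)) ≥ 0`, first-order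
  axiomatizable iff CIT (Propositions of §2.5 and §2.6).
* Kirby, *Variants of Schanuel's conjecture*, arXiv:1801.08765 [Kirby2018Variants], §3:
  "Conjecture 3.3 ((SSC), Strong Schanuel conjecture). The statement of (SC) holds for all
  ultrapowers of `ℂ_exp` (including `ℂ_exp` itself). Equivalently, (SC) is true of `ℂ_exp` and
  is part of its first order theory. Added in 2018: The conjecture (SSC) is false. See [ECFCIT]
  for a discussion of the issue."; §1 (Introduction): "Conjecture (SSC) is false but the issue
  of what part of Schanuel's conjecture is first-order expressible is discussed in [ECFCIT]";
  Prop. 1.6 and the remark "The implication (SC over the kernel) ⟹ (SC) is true, because `2πi`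
  is transcendental, and the kernel is a cyclic group. However the equivalent implication is not
  necessarily true for other exponential fields."

## Lean rendering

* `expKernelMultipliers F` is `Z(F)` as a subring (membership: `∀ y, exp y = 1 → exp (r y) = 1`);
  `kzTuple r t = (rt, r²t, r³t)` is the printed family `{rⁿt}` truncated at `n = 3`, which
  suffices: it is `ℚ`-linearly independent as soon as `r` satisfies no rational quadratic
  relation (`NoRatQuadraticRelation`, implied by `Transcendental ℚ r`) and `t ≠ 0`, its
  exponentials are `1` when `r ∈ Z(F)`, `exp t = 1`, and `ℚ(rt, r²t, r³t, 1) = ℚ(rt, r²t)`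
  (`(r²t)² = (rt)(r³t)`) has transcendence degree `≤ 2 < 3`
  (`not_schanuelProperty_of_kernelMultiplier`; tree's `Literature.ModelTheory.ExponentialFields.SchanuelProperty`).
* `Ultrapower F := Filter.Germ (hyperfilter ℕ) F` with Mathlib's field structure
  (`Filter.Germ.instField`), `CharZero`, and the coordinatewise exponential
  (`instExponentialRing`); `omega F` is the class of `(0, 1, 2, …)`, `diag t` the class of the
  constant sequence `t`. PROVED: `omega F ∈ Z`, `omega F` is transcendental over `ℚ`,
  `exp (diag t) = 1`, `diag t ≠ 0`; so `¬ SchanuelProperty (Ultrapower F)` whenever `F` has a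
  non-zero kernel element (`not_schanuelProperty_ultrapower`), in particular for `F = ℂ`
  (`t = 2πi`).
* Łoś: the `expRing`-structure of `Ultrapower F` is Mathlib's ultraproduct structure on the
  (definitionally equal) filter product (`Ultrapower.structure_eq`), whence
  `Ultrapower F ≅[Language.expRing] F` (`ultrapower_elementarilyEquivalent`).
* The explicit technique class is `StrongSchanuelConjecture := ∀ exponential fields `M` of
  characteristic zero, `M ≅[expRing] ℂ → SchanuelProperty M` ("(SC) is true of `ℂ_exp` and is
  part of its first order theory"); REFUTED. Corollaries: `schanuelProperty_not_elementary_of_schanuel`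
  (under SC, two elementarily equivalent exponential fields disagree on the Schanuel property),
  `not_axiomatisable_of_schanuelProperty` / `_of_exists_isZilberField` (no
  `T : Language.expRing.Theory` has the Schanuel fields as its models among exponential fields
  with a non-trivial kernel element, resp. among all exponential fields of characteristic zero).

## References

* [KirbyZilber2014] J. Kirby, B. Zilber, *Exponentially closed fields and the conjecture on
  intersections with tori*, Ann. Pure Appl. Logic 165 (2014) 1680–1706, arXiv:1108.1075: §1,
  §2.1, §2.2–2.6.
* [Kirby2018Variants] J. Kirby, *Variants of Schanuel's conjecture*, arXiv:1801.08765 (notes,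
  2007/2018): §1, Prop. 1.6, §3 Conj. 3.1 (USC), Conj. 3.3 (SSC) and the 2018 remark.
* [Zilber2005] B. Zilber, *Pseudo-exponentiation on algebraically closed fields of
  characteristic zero*, APAL 132 (2005) (the axioms; tree `IsZilberField`,
  `exists_isZilberField_of_aleph0_lt`).
-/

noncomputable section

open Cardinal

namespace Literature.Barriers.Schanuel

open Literature.ModelTheory.ExponentialFields.ExponentialRing

/-! ### `Z(F)` and the Kirby–Zilber tuple `(rt, r²t, r³t)` in an arbitrary exponential field -/

section General

variable {F : Type*} [Field F] [CharZero F] [Literature.ModelTheory.ExponentialFields.ExponentialRing F]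

/-- **The multiplicative stabiliser of the kernel**, `Z(F) = {r ∈ F | ∀x[x ∈ ker → rx ∈ ker]}`,
as a subring of the exponential field `F` ("`Z(F)` is a subring of `F`"; in any ELA-field with
standard kernel `Z(F) = ℤ`). [cite: KirbyZilber2014, §1 (definition of Z(F)) and §2.1] -/
def expKernelMultipliers (F : Type*) [Field F] [Literature.ModelTheory.ExponentialFields.ExponentialRing F] : Subring F where
  carrier := {r | ∀ y : F, exp y = 1 → exp (r * y) = 1}
  one_mem' := by intro y hy; simpa using hy
  mul_mem' {a b} ha hb := by
    intro y hy
    rw [mul_assoc]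
    exact ha _ (hb _ hy)
  zero_mem' := by intro y hy; simp
  add_mem' {a b} ha hb := by
    intro y hy
    rw [add_mul, exp_add, ha _ hy, hb _ hy, one_mul]
  neg_mem' {a} ha := by
    intro y hy
    have h1 := ha y hy
    have h2 := exp_mul_exp_neg (a * y)
    rw [h1, one_mul, ← neg_mul] at h2
    exact h2

omit [CharZero F] in
/-- Membership in `Z(F)`: `r ∈ Z(F)` iff `exp (r y) = 1` whenever `exp y = 1`.
[cite: KirbyZilber2014, §1 (definition of Z(F))] -/
theorem mem_expKernelMultipliers_iff {r : F} :
    r ∈ expKernelMultipliers F ↔ ∀ y : F, exp y = 1 → exp (r * y) = 1 := Iff.rfl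

omit [CharZero F] in
/-- `ℤ ⊆ Z(F)` in every exponential field (a subring contains the integers); non-standard
elements of `Z(F)` are the issue. [cite: KirbyZilber2014, §1] -/
theorem intCast_mem_expKernelMultipliers (m : ℤ) : (m : F) ∈ expKernelMultipliers F :=
  intCast_mem _ m

/-- `r` satisfies **no rational quadratic relation**: `a + b r + c r² = 0` with `a, b, c ∈ ℚ`
forces `a = b = c = 0` — i.e. `1, r, r²` are `ℚ`-linearly independent, the truncation at degree
`2` of "`{rⁿ | n ∈ ℕ}` is `ℚ`-linearly independent" for transcendental `r`
(`noRatQuadraticRelation_of_transcendental`). Stated with the casts `ℚ → F` of the division ring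
`F` only. [cite: KirbyZilber2014, §2.1] -/
def NoRatQuadraticRelation (r : F) : Prop :=
  ∀ a b c : ℚ, (a : F) + (b : F) * r + (c : F) * r ^ 2 = 0 → a = 0 ∧ b = 0 ∧ c = 0

omit [CharZero F] [Literature.ModelTheory.ExponentialFields.ExponentialRing F] in
/-- Such an `r` is non-zero (`r = 0` is the relation `0 + 1·r + 0·r² = 0`). [folklore] -/
theorem NoRatQuadraticRelation.ne_zero {r : F} (hr : NoRatQuadraticRelation r) : r ≠ 0 := by
  intro h
  have := (hr 0 1 0 (by simp [h])).2.1
  exact one_ne_zero this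

omit [Literature.ModelTheory.ExponentialFields.ExponentialRing F] in
/-- A transcendental element satisfies no rational quadratic relation ("suppose `r ∈ Z(F)` is
transcendental. Then `{rⁿ | n ∈ ℕ}` is `ℚ`-linearly independent"). [cite: KirbyZilber2014, §2.1] -/
theorem noRatQuadraticRelation_of_transcendental {r : F} (hr : Transcendental ℚ r) :
    NoRatQuadraticRelation r := by
  intro a b c habc
  by_contra hne
  apply hr
  refine ⟨Polynomial.C c * Polynomial.X ^ 2 + Polynomial.C b * Polynomial.X +
    Polynomial.C a, ?_, ?_⟩
  · intro h0
    have h2 := congrArg (fun p => Polynomial.coeff p 2) h0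
    have h1 := congrArg (fun p => Polynomial.coeff p 1) h0
    have h00 := congrArg (fun p => Polynomial.coeff p 0) h0
    simp [Polynomial.coeff_X_pow, Polynomial.coeff_X, Polynomial.coeff_C] at h2 h1 h00
    exact hne ⟨h00, h1, h2⟩
  · simp only [map_add, map_mul, Polynomial.aeval_C, Polynomial.aeval_X_pow, Polynomial.aeval_X,
      eq_ratCast]
    rw [← habc]
    ring

/-- **The Kirby–Zilber tuple** `(rt, r²t, r³t)`: the first three members of the family
`{rⁿt | n ∈ ℕ} ⊆ ker(F)`. [cite: KirbyZilber2014, §2.1] -/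
def kzTuple (r t : F) : Fin 3 → F := ![r * t, r ^ 2 * t, r ^ 3 * t]

omit [CharZero F] in
/-- If `r ∈ Z(F)` and `t ∈ ker`, the whole tuple lies in the kernel: `exp (rⁿt) = 1`
("`{rⁿt | n ∈ ℕ}` lies in `ker(F)`"). PROVED. [cite: KirbyZilber2014, §2.1] -/
theorem exp_kzTuple {r t : F} (hr : r ∈ expKernelMultipliers F) (ht : exp t = 1) (i : Fin 3) :
    exp (kzTuple r t i) = 1 := by
  have h1 : exp (r * t) = 1 := hr _ ht
  have h2 : exp (r ^ 2 * t) = 1 := by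
    have := hr _ h1; rwa [← mul_assoc, ← pow_two] at this
  have h3 : exp (r ^ 3 * t) = 1 := by
    have := hr _ h2; rwa [← mul_assoc, ← pow_succ'] at this
  fin_cases i
  · exact h1
  · exact h2
  · exact h3

omit [Literature.ModelTheory.ExponentialFields.ExponentialRing F] in
/-- The tuple `(rt, r²t, r³t)` is `ℚ`-linearly independent when `r` satisfies no rational
quadratic relation and `t ≠ 0` (a relation `∑ qᵢ rⁱ t = 0` is `(q₁ + q₂ r + q₃ r²) r t = 0`)
("and is `ℚ`-linearly independent"). PROVED. [cite: KirbyZilber2014, §2.1] -/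
theorem linearIndependent_kzTuple {r t : F} (hr : NoRatQuadraticRelation r) (ht : t ≠ 0) :
    LinearIndependent ℚ (kzTuple r t) := by
  have hr0 : r ≠ 0 := hr.ne_zero
  rw [Fintype.linearIndependent_iff]
  intro g hg i
  have hsum : ∑ j, g j • kzTuple r t j =
      ((g 0 : F) + (g 1 : F) * r + (g 2 : F) * r ^ 2) * r * t := by
    simp only [Fin.sum_univ_three, kzTuple, Matrix.cons_val_zero, Matrix.cons_val_one,
      Matrix.cons_val, Rat.smul_def]
    ring
  rw [hsum] at hg
  have hq : (g 0 : F) + (g 1 : F) * r + (g 2 : F) * r ^ 2 = 0 := by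
    rcases mul_eq_zero.mp hg with h | h
    · rcases mul_eq_zero.mp h with h' | h'
      · exact h'
      · exact absurd h' hr0
    · exact absurd h ht
  obtain ⟨h0, h1, h2⟩ := hr _ _ _ hq
  fin_cases i
  · exact h0
  · exact h1
  · exact h2

/-- `trdeg_K K(a, b) ≤ 2` for any two elements of a field extension (a transcendence basis can
be chosen among the generators). [folklore] -/
theorem trdeg_adjoin_pair_le_two {K E : Type*} [Field K] [Field E] [Algebra K E] (a b : E) :
    Algebra.trdeg K (IntermediateField.adjoin K ({a, b} : Set E)) ≤ 2 := by
  haveI := Literature.NumberTheory.Transcendental.isAlgebraic_adjoin_over_algebraAdjoin (F := K) ({a, b} : Set E)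
  refine (Algebra.IsAlgebraic.trdeg_le_cardinalMk K
    (((↑) : IntermediateField.adjoin K ({a, b} : Set E) → E) ⁻¹' ({a, b} : Set E))).trans ?_
  refine (Cardinal.mk_preimage_of_injective _ _ Subtype.val_injective).trans ?_
  refine (Cardinal.mk_insert_le).trans ?_
  rw [Cardinal.mk_singleton]
  norm_num

/-- "… but of transcendence degree only 2": the field `ℚ(rt, r²t, r³t, exp(rt), exp(r²t),
exp(r³t)) = ℚ(rt, r²t, r³t, 1)` is contained in `ℚ(rt, r²t)` (`r³t = (r²t)²(rt)⁻¹`), of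
transcendence degree `≤ 2`. PROVED. [cite: KirbyZilber2014, §2.1] -/
theorem trdeg_kzTuple_le_two {r t : F} (hr : r ∈ expKernelMultipliers F) (hr0 : r ≠ 0)
    (ht : exp t = 1) (ht0 : t ≠ 0) :
    Algebra.trdeg ℚ (IntermediateField.adjoin ℚ
      (Set.range (kzTuple r t) ∪ Set.range (exp ∘ kzTuple r t))) ≤ 2 := by
  have ha : r * t ∈ IntermediateField.adjoin ℚ ({r * t, r ^ 2 * t} : Set F) :=
    IntermediateField.subset_adjoin ℚ _ (Set.mem_insert _ _)
  have hb : r ^ 2 * t ∈ IntermediateField.adjoin ℚ ({r * t, r ^ 2 * t} : Set F) :=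
    IntermediateField.subset_adjoin ℚ _ (Set.mem_insert_of_mem _ (Set.mem_singleton _))
  have hle : IntermediateField.adjoin ℚ
      (Set.range (kzTuple r t) ∪ Set.range (exp ∘ kzTuple r t)) ≤
      IntermediateField.adjoin ℚ ({r * t, r ^ 2 * t} : Set F) := by
    rw [IntermediateField.adjoin_le_iff]
    rintro y (⟨i, rfl⟩ | ⟨i, rfl⟩)
    · fin_cases i
      · exact ha
      · exact hb
      · have : r ^ 3 * t = (r ^ 2 * t) ^ 2 * (r * t)⁻¹ := by
          field_simp
        show r ^ 3 * t ∈ IntermediateField.adjoin ℚ ({r * t, r ^ 2 * t} : Set F)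
        rw [this]
        exact mul_mem (pow_mem hb 2) (inv_mem ha)
    · rw [SetLike.mem_coe, Function.comp_apply, exp_kzTuple hr ht i]
      exact one_mem _
  exact (trdeg_le_of_injective (IntermediateField.inclusion hle)
    (IntermediateField.inclusion_injective hle)).trans (trdeg_adjoin_pair_le_two _ _)

/-- **Kirby–Zilber, §2.1 (for an arbitrary exponential field): a transcendental — indeed any
quadratically free — kernel multiplier together with a non-zero kernel element destroys the
Schanuel property.** If `r ∈ Z(F)` satisfies no rational quadratic relation and `t ≠ 0`,
`exp t = 1`, then `(rt, r²t, r³t)` is a `ℚ`-linearly independent triple with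
`trdeg ℚ(x, exp x) ≤ 2 < 3`, so `¬ SchanuelProperty F` (tree: `Literature.ModelTheory.ExponentialFields.SchanuelProperty`). PROVED.
[cite: KirbyZilber2014, §2.1] -/
theorem not_schanuelProperty_of_kernelMultiplier {r t : F}
    (hr : r ∈ expKernelMultipliers F) (hrq : NoRatQuadraticRelation r) (ht : exp t = 1)
    (ht0 : t ≠ 0) : ¬ Literature.ModelTheory.ExponentialFields.SchanuelProperty F := by
  intro hSP
  have h3 := hSP 3 (kzTuple r t) (linearIndependent_kzTuple hrq ht0)
  have h2 := trdeg_kzTuple_le_two hr hrq.ne_zero ht ht0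
  have : ((3 : ℕ) : Cardinal) ≤ 2 := h3.trans h2
  norm_num at this

/-- The printed form: "suppose `r ∈ Z(F)` is transcendental … for any `t ∈ ker(F)`" (non-zero),
the Schanuel property fails. PROVED. [cite: KirbyZilber2014, §2.1] -/
theorem not_schanuelProperty_of_transcendental_kernelMultiplier {r t : F}
    (hr : r ∈ expKernelMultipliers F) (hrt : Transcendental ℚ r) (ht : exp t = 1)
    (ht0 : t ≠ 0) : ¬ Literature.ModelTheory.ExponentialFields.SchanuelProperty F :=
  not_schanuelProperty_of_kernelMultiplier hr (noRatQuadraticRelation_of_transcendental hrt) ht ht0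

omit [CharZero F] in
/-- `exp (n x) = (exp x)ⁿ` in any exponential ring. [folklore] -/
theorem exp_natCast_mul (n : ℕ) (x : F) : exp ((n : F) * x) = exp x ^ n := by
  induction n with
  | zero => simp
  | succ n ih => rw [Nat.cast_succ, add_mul, one_mul, exp_add, ih, pow_succ]

end General

/-! ### The ultrapower `F^ℕ/𝒰` of an exponential field, as an exponential field, and Łoś -/

section Ultrapower

open Filter

/-- **The ultrapower `F^ℕ/𝒰`** of `F` over the hyperfilter `𝒰` on `ℕ` (a non-principal
ultrafilter): Mathlib's germs `Filter.Germ 𝒰 F`, a field when `F` is (`Filter.Germ.instField`).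
For `F = ℂ` these are the "ultrapowers of `ℂ_exp`" of the Strong Schanuel Conjecture.
[cite: Kirby2018Variants, §3 Conjecture 3.3] -/
abbrev Ultrapower (F : Type) : Type := Filter.Germ (hyperfilter ℕ : Filter ℕ) F

/-- Equality of germs of sequences is eventual equality along `𝒰`. [folklore] -/
theorem Ultrapower.coe_eq_coe_iff {F : Type} {f g : ℕ → F} :
    (f : Ultrapower F) = (g : Ultrapower F) ↔ ∀ᶠ n in (hyperfilter ℕ : Filter ℕ), f n = g n :=
  Filter.Germ.coe_eq

/-- Members of a non-principal ultrafilter on `ℕ` are infinite. [folklore] -/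
theorem infinite_of_mem_hyperfilter {S : Set ℕ} (hS : S ∈ (hyperfilter ℕ : Filter ℕ)) :
    S.Infinite := fun hfin =>
  Filter.notMem_hyperfilter_of_finite hfin (by simpa using hS)

variable {F : Type} [Field F]

/-- The ultrapower of a field of characteristic zero has characteristic zero. [folklore] -/
instance Ultrapower.instCharZero [CharZero F] : CharZero (Ultrapower F) where
  cast_injective m n h := by
    have h' : ((fun _ : ℕ => (m : F)) : Ultrapower F) = ((fun _ : ℕ => (n : F)) : Ultrapower F) := by
      rw [Filter.Germ.natCast_def, Filter.Germ.natCast_def]; exact h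
    rw [Ultrapower.coe_eq_coe_iff] at h'
    obtain ⟨k, hk⟩ := h'.exists
    exact_mod_cast hk

/-- **The ultrapower as an exponential field**: `exp` acts coordinatewise on germs
(`Filter.Germ.map exp`); `exp 0 = 1` and `exp (x + y) = exp x · exp y` hold coordinatewise.
[cite: Kirby2018Variants, §3 Conjecture 3.3] -/
instance Ultrapower.instExponentialRing [Literature.ModelTheory.ExponentialFields.ExponentialRing F] : Literature.ModelTheory.ExponentialFields.ExponentialRing (Ultrapower F) where
  exp := Filter.Germ.map Literature.ModelTheory.ExponentialFields.ExponentialRing.exp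
  exp_zero := by
    rw [← Filter.Germ.coe_zero, Filter.Germ.map_coe, ← Filter.Germ.coe_one]
    congr 1
    funext n
    simp
  exp_add x y := by
    refine Filter.Germ.inductionOn₂ x y fun f g => ?_
    rw [← Filter.Germ.coe_add, Filter.Germ.map_coe, Filter.Germ.map_coe, Filter.Germ.map_coe,
      ← Filter.Germ.coe_mul]
    congr 1
    funext n
    simp [Literature.ModelTheory.ExponentialFields.ExponentialRing.exp_add]

/-- `exp` of the germ of a sequence is the germ of the sequence of exponentials. [folklore] -/
theorem Ultrapower.exp_coe [Literature.ModelTheory.ExponentialFields.ExponentialRing F] (f : ℕ → F) :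
    Literature.ModelTheory.ExponentialFields.ExponentialRing.exp (f : Ultrapower F) = ((Literature.ModelTheory.ExponentialFields.ExponentialRing.exp ∘ f : ℕ → F) : Ultrapower F) :=
  Filter.Germ.map_coe _ _

variable (F) in
/-- **`ω`**, the germ of the sequence `(0, 1, 2, …)`: a non-standard natural number of the
ultrapower. [cite: KirbyZilber2014, §2.1 ("suppose r ∈ Z(F) is transcendental")] -/
def omega : Ultrapower F := ((fun n : ℕ => (n : F)) : Ultrapower F)

/-- The diagonal image of `t ∈ F` (germ of the constant sequence). [folklore] -/
def diag (t : F) : Ultrapower F := ((fun _ : ℕ => t) : Ultrapower F)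

/-- A kernel element of `F` stays in the kernel of the ultrapower. [folklore] -/
theorem exp_diag_eq_one [Literature.ModelTheory.ExponentialFields.ExponentialRing F] {t : F} (ht : Literature.ModelTheory.ExponentialFields.ExponentialRing.exp t = 1) :
    Literature.ModelTheory.ExponentialFields.ExponentialRing.exp (diag t) = 1 := by
  rw [diag, Ultrapower.exp_coe, ← Filter.Germ.coe_one]
  congr 1
  funext n
  simp [ht]

/-- The diagonal image of a non-zero element is non-zero. [folklore] -/
theorem diag_ne_zero {t : F} (ht : t ≠ 0) : diag t ≠ 0 := by
  intro h
  rw [diag, ← Filter.Germ.coe_zero, Ultrapower.coe_eq_coe_iff] at h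
  obtain ⟨n, hn⟩ := h.exists
  exact ht hn

/-- **`ω ∈ Z(F^ℕ/𝒰)`**: multiplication by the non-standard integer `ω` preserves the kernel
(coordinatewise `exp (n yₙ) = (exp yₙ)ⁿ = 1`). PROVED. [cite: KirbyZilber2014, §2.1] -/
theorem omega_mem_expKernelMultipliers [Literature.ModelTheory.ExponentialFields.ExponentialRing F] :
    omega F ∈ expKernelMultipliers (Ultrapower F) := by
  intro y hy
  induction y using Filter.Germ.inductionOn with
  | h f =>
    rw [Ultrapower.exp_coe, ← Filter.Germ.coe_one, Ultrapower.coe_eq_coe_iff] at hy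
    rw [omega, ← Filter.Germ.coe_mul, Ultrapower.exp_coe, ← Filter.Germ.coe_one,
      Ultrapower.coe_eq_coe_iff]
    filter_upwards [hy] with n hn
    simp only [Function.comp_apply, Pi.mul_apply, Pi.one_apply] at hn ⊢
    rw [exp_natCast_mul, hn, one_pow]

/-- Rational constants of the ultrapower are germs of constant sequences. [folklore] -/
theorem Ultrapower.ratCast_eq_coe (q : ℚ) :
    (q : Ultrapower F) = ((fun _ : ℕ => (q : F)) : Ultrapower F) := by
  rw [Rat.cast_def q, ← Filter.Germ.intCast_def, ← Filter.Germ.natCast_def, ← Filter.Germ.coe_div]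
  congr 1
  funext n
  simp only [Pi.div_apply]
  rw [Rat.cast_def]

/-- **`ω` satisfies no rational quadratic relation**: such a relation would hold coordinatewise on
a set in `𝒰`, giving a non-zero rational quadratic with infinitely many roots. PROVED.
[cite: KirbyZilber2014, §2.1] -/
theorem noRatQuadraticRelation_omega [CharZero F] : NoRatQuadraticRelation (omega F) := by
  intro a b c h
  rw [Ultrapower.ratCast_eq_coe a, Ultrapower.ratCast_eq_coe b, Ultrapower.ratCast_eq_coe c,
    omega, ← Filter.Germ.coe_pow, ← Filter.Germ.coe_mul, ← Filter.Germ.coe_mul,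
    ← Filter.Germ.coe_add, ← Filter.Germ.coe_add, ← Filter.Germ.coe_zero,
    Ultrapower.coe_eq_coe_iff] at h
  have hS : {n : ℕ | (a : F) + b * n + c * (n : F) ^ 2 = 0} ∈ (hyperfilter ℕ : Filter ℕ) := by
    filter_upwards [h] with n hn
    simpa using hn
  have hinf := infinite_of_mem_hyperfilter hS
  set P : Polynomial ℚ := Polynomial.C a + Polynomial.C b * Polynomial.X +
    Polynomial.C c * Polynomial.X ^ 2 with hP
  have hroots : Set.Infinite {x : ℚ | P.IsRoot x} := by
    refine (hinf.image Nat.cast_injective.injOn).mono ?_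
    rintro _ ⟨n, hn, rfl⟩
    simp only [Set.mem_setOf_eq] at hn ⊢
    simp only [hP, Polynomial.IsRoot, Polynomial.eval_add, Polynomial.eval_mul, Polynomial.eval_C,
      Polynomial.eval_X, Polynomial.eval_pow]
    apply (algebraMap ℚ F).injective
    rw [map_zero]
    simpa [eq_ratCast] using hn
  have hP0 : P = 0 := Polynomial.eq_zero_of_infinite_isRoot P hroots
  have h0 := congrArg (fun p => Polynomial.coeff p 0) hP0
  have h1 := congrArg (fun p => Polynomial.coeff p 1) hP0
  have h2 := congrArg (fun p => Polynomial.coeff p 2) hP0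
  simp [hP, Polynomial.coeff_X_pow, Polynomial.coeff_X, Polynomial.coeff_C] at h0 h1 h2
  exact ⟨h0, h1, h2⟩

/-- Polynomial evaluation at a germ is coordinatewise. [folklore] -/
theorem Ultrapower.aeval_coe [CharZero F] (f : ℕ → F) (p : Polynomial ℚ) :
    Polynomial.aeval (f : Ultrapower F) p =
      ((fun n => Polynomial.aeval (f n) p : ℕ → F) : Ultrapower F) := by
  induction p using Polynomial.induction_on' with
  | add p q hp hq =>
    rw [map_add, hp, hq, ← Filter.Germ.coe_add]
    congr 1
    funext n
    simp
  | monomial k a =>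
    rw [Polynomial.aeval_monomial, eq_ratCast, Ultrapower.ratCast_eq_coe, ← Filter.Germ.coe_pow,
      ← Filter.Germ.coe_mul]
    congr 1
    funext n
    simp [Polynomial.aeval_monomial]

/-- **`ω` is transcendental over `ℚ`** (the printed hypothesis "`r ∈ Z(F)` is transcendental"):
a rational polynomial vanishing at `ω` vanishes at infinitely many natural numbers. PROVED.
[cite: KirbyZilber2014, §2.1] -/
theorem transcendental_omega [CharZero F] : Transcendental ℚ (omega F) := by
  rintro ⟨p, hp0, hp⟩
  rw [omega, Ultrapower.aeval_coe, ← Filter.Germ.coe_zero, Ultrapower.coe_eq_coe_iff] at hp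
  have hS : {n : ℕ | Polynomial.aeval (n : F) p = 0} ∈ (hyperfilter ℕ : Filter ℕ) := by
    filter_upwards [hp] with n hn
    simpa using hn
  have hinf := infinite_of_mem_hyperfilter hS
  apply hp0
  apply Polynomial.eq_zero_of_infinite_isRoot
  refine (hinf.image Nat.cast_injective.injOn).mono ?_
  rintro _ ⟨n, hn, rfl⟩
  simp only [Set.mem_setOf_eq] at hn ⊢
  have h2 : algebraMap ℚ F (p.eval (n : ℚ)) = 0 := by
    rw [← Polynomial.aeval_algebraMap_apply_eq_algebraMap_eval, eq_ratCast]
    simpa using hn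
  exact (algebraMap ℚ F).injective (by simpa using h2)

/-- **The Schanuel property fails in the ultrapower of every exponential field with a non-zero
kernel element** (e.g. every field with standard kernel, every `ℂ_exp`, every Zilber field):
witness `(ωt, ω²t, ω³t)`. PROVED. [cite: KirbyZilber2014, §2.1] [cite: Kirby2018Variants, §3 Conjecture 3.3 and the 2018 remark] -/
theorem not_schanuelProperty_ultrapower [CharZero F] [Literature.ModelTheory.ExponentialFields.ExponentialRing F] {t : F}
    (ht : Literature.ModelTheory.ExponentialFields.ExponentialRing.exp t = 1) (ht0 : t ≠ 0) : ¬ Literature.ModelTheory.ExponentialFields.SchanuelProperty (Ultrapower F) :=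
  not_schanuelProperty_of_kernelMultiplier omega_mem_expKernelMultipliers
    noRatQuadraticRelation_omega (exp_diag_eq_one ht) (diag_ne_zero ht0)

/-! #### Łoś -/

open FirstOrder FirstOrder.Language

variable (F) in
omit [Field F] in
/-- The ultrapower is, as a type, Mathlib's filter product `∏_𝒰 F` (by `rfl`). [folklore] -/
theorem Ultrapower_eq_product :
    Ultrapower F = ((hyperfilter ℕ : Filter ℕ).Product fun _ : ℕ => F) := rfl

variable (F) in
/-- The `(+, ·, −, 0, 1, exp)`-structure of the exponential field `Ultrapower F` (tree:
`Language.expRing.instStructure`) IS Mathlib's ultraproduct structure on `∏_𝒰 F` (both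
interpret every symbol coordinatewise). PROVED. [folklore] -/
theorem Ultrapower.structure_eq [Literature.ModelTheory.ExponentialFields.ExponentialRing F] :
    (Literature.ModelTheory.ExponentialFields.Language.expRing.instStructure : Literature.ModelTheory.ExponentialFields.Language.expRing.Structure (Ultrapower F)) =
      (Ultraproduct.structure :
        Literature.ModelTheory.ExponentialFields.Language.expRing.Structure ((hyperfilter ℕ : Filter ℕ).Product fun _ : ℕ => F)) := by
  refine Language.Structure.ext ?_ ?_
  · funext n f v
    induction v using Quotient.induction_on_pi with
    | h a =>
      have h2 : @Structure.funMap Literature.ModelTheory.ExponentialFields.Language.expRing _ Ultraproduct.structure n f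
          (fun i => ((a i : ℕ → F) : (hyperfilter ℕ : Filter ℕ).Product fun _ : ℕ => F)) =
          ((fun k => @Structure.funMap Literature.ModelTheory.ExponentialFields.Language.expRing F _ n f fun i => a i k : ℕ → F) :
            (hyperfilter ℕ : Filter ℕ).Product fun _ : ℕ => F) :=
        Ultraproduct.funMap_cast f a
      refine Eq.trans ?_ h2.symm
      cases f <;> rfl
  · funext n r
    exact r.elim

variable (F) in
/-- **Łoś's theorem for the ultrapower of an exponential field**: a sentence of the language
`(+, ·, −, 0, 1, exp)` holds in `F^ℕ/𝒰` iff it holds in `F` (Mathlib's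
`FirstOrder.Language.Ultraproduct.sentence_realize` transported along `structure_eq`). PROVED.
[cite: Kirby2018Variants, §3 Conjecture 3.3 ("Equivalently, (SC) is true of ℂ_exp and is part of its first order theory")] -/
theorem ultrapower_realize_sentence_iff [Literature.ModelTheory.ExponentialFields.ExponentialRing F] (φ : Literature.ModelTheory.ExponentialFields.Language.expRing.Sentence) :
    Ultrapower F ⊨ φ ↔ F ⊨ φ := by
  have h1 : (Ultrapower F ⊨ φ) ↔
      @Sentence.Realize Literature.ModelTheory.ExponentialFields.Language.expRing ((hyperfilter ℕ : Filter ℕ).Product fun _ : ℕ => F)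
        Ultraproduct.structure φ := by
    show @Sentence.Realize Literature.ModelTheory.ExponentialFields.Language.expRing (Ultrapower F) Literature.ModelTheory.ExponentialFields.Language.expRing.instStructure φ ↔ _
    rw [Ultrapower.structure_eq]
    exact Iff.rfl
  rw [h1, Ultraproduct.sentence_realize]
  exact Filter.eventually_const

variable (F) in
/-- The ultrapower `F^ℕ/𝒰` is elementarily equivalent to `F` as an exponential ring. PROVED.
[cite: Kirby2018Variants, §3 Conjecture 3.3] -/
theorem ultrapower_elementarilyEquivalent [Literature.ModelTheory.ExponentialFields.ExponentialRing F] :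
    (Ultrapower F ≅[Literature.ModelTheory.ExponentialFields.Language.expRing] F) :=
  elementarilyEquivalent_iff.mpr (ultrapower_realize_sentence_iff F)

end Ultrapower

/-! ### Consequences for `ℂ_exp`: the Strong Schanuel Conjecture is false -/

section Complex

open FirstOrder FirstOrder.Language

/-- **The ultrapower `ℂ^ℕ/𝒰` of `ℂ_exp` violates the Schanuel property** (`t = 2πi`), although
it is elementarily equivalent to `ℂ_exp` (`ultrapower_elementarilyEquivalent ℂ`). PROVED.
[cite: KirbyZilber2014, §2.1] [cite: Kirby2018Variants, §3 (2018 remark: "(SSC) is false")] -/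
theorem not_schanuelProperty_ultrapower_complex : ¬ Literature.ModelTheory.ExponentialFields.SchanuelProperty (Ultrapower ℂ) := by
  refine not_schanuelProperty_ultrapower (t := (2 * Real.pi * Complex.I : ℂ)) ?_ ?_
  · show Complex.exp (2 * Real.pi * Complex.I) = 1
    exact Complex.exp_two_pi_mul_I
  · simp [Real.pi_ne_zero, Complex.I_ne_zero]

/-- **The Strong Schanuel Conjecture (SSC)** — the explicit technique class of this barrier:
"The statement of (SC) holds for all ultrapowers of `ℂ_exp` (including `ℂ_exp` itself).
Equivalently, (SC) is true of `ℂ_exp` and is part of its first order theory", rendered as: every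
exponential field of characteristic zero elementarily equivalent to `ℂ_exp` in the language
`(+, ·, −, 0, 1, exp)` has the Schanuel property (this contains `ℂ_exp` itself and all its
ultrapowers, `ultrapower_elementarilyEquivalent`). It is the form of Schanuel's conjecture that
a proof by first-order transfer/compactness from the complete theory of `ℂ_exp` would establish.
FALSE (`not_strongSchanuelConjecture`). [cite: Kirby2018Variants, §3 Conjecture 3.3] -/
@[conjecture] def StrongSchanuelConjecture : Prop :=
  ∀ (M : Type) (_ : Field M) (_ : CharZero M) (_ : Literature.ModelTheory.ExponentialFields.ExponentialRing M),
    (M ≅[Literature.ModelTheory.ExponentialFields.Language.expRing] ℂ) → Literature.ModelTheory.ExponentialFields.SchanuelProperty M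

/-- **SSC is false** ("Added in 2018: The conjecture (SSC) is false. See [ECFCIT]"): the
ultrapower `ℂ^ℕ/𝒰` is elementarily equivalent to `ℂ_exp` and violates the Schanuel property.
PROVED. [cite: Kirby2018Variants, §3 Conjecture 3.3 and the 2018 remark] [cite: KirbyZilber2014, §2.1] -/
theorem not_strongSchanuelConjecture : ¬ StrongSchanuelConjecture := fun h =>
  not_schanuelProperty_ultrapower_complex
    (h (Ultrapower ℂ) inferInstance inferInstance inferInstance (ultrapower_elementarilyEquivalent ℂ))

/-- **If Schanuel's conjecture holds, the Schanuel property is not invariant under elementary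
equivalence**: `ℂ_exp` would have it and its ultrapower, a model of the same complete first-order
theory, does not — "the Schanuel property, is not [first-order]". PROVED (the hypothesis is the
summit, `Literature.SchanuelProperty ℂ`). [cite: KirbyZilber2014, §2.1] -/
theorem schanuelProperty_not_elementary_of_schanuel (hSC : Literature.ModelTheory.ExponentialFields.SchanuelProperty ℂ) :
    ∃ (M : Type) (_ : Field M) (_ : CharZero M) (_ : Literature.ModelTheory.ExponentialFields.ExponentialRing M),
      (M ≅[Literature.ModelTheory.ExponentialFields.Language.expRing] ℂ) ∧ Literature.ModelTheory.ExponentialFields.SchanuelProperty ℂ ∧ ¬ Literature.ModelTheory.ExponentialFields.SchanuelProperty M :=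
  ⟨Ultrapower ℂ, inferInstance, inferInstance, inferInstance, ultrapower_elementarilyEquivalent ℂ,
    hSC, not_schanuelProperty_ultrapower_complex⟩

/-- **No first-order axiomatisation of the Schanuel property, given one Schanuel field with a
non-trivial kernel**: if some exponential field `K` of characteristic zero with a non-zero
kernel element has the Schanuel property, then no theory `T` in the language
`(+, ·, −, 0, 1, exp)` satisfies "`M ⊨ T ↔ M` has the Schanuel property" for all exponential
fields `M` of characteristic zero (apply it to `K` and to `K^ℕ/𝒰 ≡ K`). PROVED.
[cite: KirbyZilber2014, §1 ("The axioms are not all first-order") and §2.1] -/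
theorem not_axiomatisable_of_schanuelProperty {K : Type} [Field K] [CharZero K]
    [Literature.ModelTheory.ExponentialFields.ExponentialRing K] (hK : Literature.ModelTheory.ExponentialFields.SchanuelProperty K) {t : K} (ht : Literature.ModelTheory.ExponentialFields.ExponentialRing.exp t = 1)
    (ht0 : t ≠ 0) :
    ¬ ∃ T : Literature.ModelTheory.ExponentialFields.Language.expRing.Theory, ∀ (M : Type) (_ : Field M) (_ : CharZero M)
      (_ : Literature.ModelTheory.ExponentialFields.ExponentialRing M), (M ⊨ T ↔ Literature.ModelTheory.ExponentialFields.SchanuelProperty M) := by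
  rintro ⟨T, hT⟩
  have h1 : K ⊨ T := (hT K inferInstance inferInstance inferInstance).mpr hK
  have h2 : Ultrapower K ⊨ T := by
    refine ⟨fun φ hφ => ?_⟩
    rw [ultrapower_realize_sentence_iff]
    exact h1.realize_of_mem φ hφ
  exact not_schanuelProperty_ultrapower ht ht0
    ((hT (Ultrapower K) inferInstance inferInstance inferInstance).mp h2)

/-- The same, unconditionally in `ℂ`'s conjecture but using **Zilber's existence theorem**
(tree fact `Literature.NumberTheory.Transcendental.exists_isZilberField_of_aleph0_lt`: a Zilber field of cardinality `ℵ₁`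
exists; it has the Schanuel property and standard kernel `τℤ`, `τ` transcendental, `exp τ = 1`):
the class of exponential fields of characteristic zero with the Schanuel property is not the
class of models of any first-order theory in `(+, ·, −, 0, 1, exp)` — "The axioms are not all
first-order, but can all be expressed in the logic `L_{ω₁,ω}(Q)`". PROVED from the named fact.
[cite: KirbyZilber2014, §1 and §2.1] [cite: Zilber2005, Thm 1.1] -/
theorem not_axiomatisable_of_exists_isZilberField (hZ : Literature.NumberTheory.Transcendental.exists_isZilberField_of_aleph0_lt) :
    ¬ ∃ T : Literature.ModelTheory.ExponentialFields.Language.expRing.Theory, ∀ (M : Type) (_ : Field M) (_ : CharZero M)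
      (_ : Literature.ModelTheory.ExponentialFields.ExponentialRing M), (M ⊨ T ↔ Literature.ModelTheory.ExponentialFields.SchanuelProperty M) := by
  obtain ⟨K, _, _, _, hK, -⟩ := hZ (ℵ_ 1) (by
    rw [← Cardinal.aleph_zero]
    exact Cardinal.aleph_lt_aleph.mpr zero_lt_one)
  obtain ⟨τ, hτ, hker⟩ := hK.hasStandardKernel
  have hτker : τ ∈ Literature.ModelTheory.ExponentialFields.ExponentialRing.expKernel K := by
    rw [hker]; exact AddSubgroup.mem_zmultiples τ
  have hτ0 : τ ≠ 0 := fun h => hτ (h ▸ isAlgebraic_zero)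
  exact not_axiomatisable_of_schanuelProperty hK.schanuelProperty hτker hτ0

/-- … and from Schanuel's conjecture itself (`K = ℂ`, `t = 2πi`). PROVED. [cite: KirbyZilber2014, §2.1] -/
theorem not_axiomatisable_of_schanuel (hSC : Literature.ModelTheory.ExponentialFields.SchanuelProperty ℂ) :
    ¬ ∃ T : Literature.ModelTheory.ExponentialFields.Language.expRing.Theory, ∀ (M : Type) (_ : Field M) (_ : CharZero M)
      (_ : Literature.ModelTheory.ExponentialFields.ExponentialRing M), (M ⊨ T ↔ Literature.ModelTheory.ExponentialFields.SchanuelProperty M) := by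
  refine not_axiomatisable_of_schanuelProperty hSC (t := (2 * Real.pi * Complex.I : ℂ)) ?_ ?_
  · show Complex.exp (2 * Real.pi * Complex.I) = 1
    exact Complex.exp_two_pi_mul_I
  · simp [Real.pi_ne_zero, Complex.I_ne_zero]

/-! ### The catalogue declaration -/

/-- **Barrier (catalogue declaration): the Schanuel property is not first-order; the Strong
Schanuel Conjecture is false.** Conjunction, entirely PROVED
(`schanuelPropertyNotFirstOrder_holds`), of:
(i) `¬ StrongSchanuelConjecture` — not every exponential field elementarily equivalent to
`ℂ_exp` has the Schanuel property;
(ii) the ultrapower `ℂ^ℕ/𝒰` is elementarily equivalent to `ℂ_exp` (Łoś) and violates the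
Schanuel property;
(iii) Kirby–Zilber's mechanism in every exponential field of characteristic zero: a
transcendental kernel multiplier `r ∈ Z(F)` and a non-zero kernel element `t` give the
`ℚ`-linearly independent kernel triple `(rt, r²t, r³t)` of transcendence degree `≤ 2`;
(iv) under the summit `SchanuelProperty ℂ`, the Schanuel property separates two elementarily
equivalent exponential fields, and no `expRing`-theory axiomatises it;
(v) the same non-axiomatisability from Zilber's existence theorem (tree named fact) instead of
the summit.

BARRIER (D-0021).
- technique_class: first-order-transfer compactness ultraproducts elementary-equivalence complete-first-order-theory-of-C_exp nonstandard-models strong-schanuel-conjecture first-order-axiomatisation-of-zilber-axioms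
- explicit_class: `StrongSchanuelConjecture` := every exponential field `M` of characteristic zero with `M ≅[Language.expRing] ℂ` (same complete first-order theory as `ℂ_exp` in `(+, ·, −, 0, 1, exp)`) has `Literature.SchanuelProperty M` — "(SC) holds for all ultrapowers of `ℂ_exp` (including `ℂ_exp` itself). Equivalently, (SC) is true of `ℂ_exp` and is part of its first order theory" [cite: Kirby2018Variants, §3 Conjecture 3.3]; i.e. any argument deriving the Schanuel property from first-order properties of `ℂ_exp` alone (transfer to/from elementarily equivalent or non-standard models, compactness, a first-order reading of Zilber's axiom 3).
- blocks: the natural strengthening SSC of the summit `Schanuel` — REFUTED (conjunct (i)); and, should `Schanuel` hold, any characterisation of it by a first-order theory of exponential rings (conjunct (iv)); Zilber's axiom 3 (= the summit for `ℂ_exp`) as a first-order scheme [cite: KirbyZilber2014, §2.1 ("axiom 3, the Schanuel property, is not")].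
- because: in an elementary extension with non-standard kernel "suppose `r ∈ Z(F)` is transcendental. Then `{rⁿ | n ∈ ℕ}` is `ℚ`-linearly independent, and it lies in `Z(F)` since `Z(F)` is a subring of `F`. So for any `t ∈ ker(F)`, `{rⁿt | n ∈ ℕ}` lies in `ker(F)` and is `ℚ`-linearly independent, is but of transcendence degree only 2" [cite: KirbyZilber2014, §2.1] — PROVED for every exponential field (`not_schanuelProperty_of_transcendental_kernelMultiplier`) and realised in the ultrapower `F^ℕ/𝒰` of any exponential field of characteristic zero with a non-zero kernel element by `r = ω = [(0,1,2,…)]`, `t` diagonal (`not_schanuelProperty_ultrapower`), which is elementarily equivalent to `F` by Łoś (`ultrapower_elementarilyEquivalent`); for `F = ℂ`, `t = 2πi` this refutes SSC, as recorded in print: "The conjecture (SSC) is false. See [ECFCIT]" [cite: Kirby2018Variants, §3 (2018 remark) and §1].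
- evasions_known: axiomatise in `L_{ω₁,ω}(Q)` instead of first-order logic — "The axioms are not all first-order, but can all be expressed in the logic `L_{ω₁,ω}(Q)`" [cite: KirbyZilber2014, §1]; replace the Schanuel property by the relative "strong kernel" axiom 3′ `Δ_F(x̄) = td(x̄, exp(x̄)/ker(F)) − ldim_ℚ(x̄/ker(F)) ≥ 0`, which is first-order expressible iff the diophantine conjecture CIT holds [cite: KirbyZilber2014, §1 (Outline) and §2.2-2.6]; Schanuel's conjecture "over the kernel" is equivalent to SC for `ℂ_exp` "because `2πi` is transcendental, and the kernel is a cyclic group. However the equivalent implication is not necessarily true for other exponential fields" [cite: Kirby2018Variants, Prop. 1.6 and remark]; "the issue of what part of Schanuel's conjecture is first-order expressible is discussed in [ECFCIT]" [cite: Kirby2018Variants, §1].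
- scope_caveats: the printed §2.1 argument is phrased for elementary extensions of `B_{ℵ₀}` (equivalently of Zilber's fields) with non-standard kernel; its verbatim extension to arbitrary exponential fields and to ultrapowers of `ℂ_exp` is this file's (elementary) formalisation, matching Kirby's unproved printed remark that SSC is false [cite: Kirby2018Variants, §3]; only the language `(+, ·, −, 0, 1, exp)` and Mathlib's first-order semantics are covered — nothing is said about `L_{ω₁,ω}(Q)`, about transfer of OTHER properties (e.g. strong kernel under CIT [cite: KirbyZilber2014, §2.5]), or about o-minimal/real versions; conjuncts (iv) are conditional on the summit and (v) on the tree's named fact `Literature.NumberTheory.Transcendental.exists_isZilberField_of_aleph0_lt` [cite: Zilber2005, Thm 1.1]; the family `{rⁿt}` is truncated to `n ≤ 3`, which is all the argument uses.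
- status: established — theorems of this file [cite: KirbyZilber2014, §2.1] [cite: Kirby2018Variants, §3 Conjecture 3.3 and the 2018 remark]. -/
def SchanuelPropertyNotFirstOrder : Prop :=
  ¬ StrongSchanuelConjecture ∧
  ((Ultrapower ℂ ≅[Literature.ModelTheory.ExponentialFields.Language.expRing] ℂ) ∧ ¬ Literature.ModelTheory.ExponentialFields.SchanuelProperty (Ultrapower ℂ)) ∧
  (∀ (F : Type) (_ : Field F) (_ : CharZero F) (_ : Literature.ModelTheory.ExponentialFields.ExponentialRing F) (r t : F),
    r ∈ expKernelMultipliers F → Transcendental ℚ r → Literature.ModelTheory.ExponentialFields.ExponentialRing.exp t = 1 → t ≠ 0 →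
      LinearIndependent ℚ (kzTuple r t) ∧ (∀ i, Literature.ModelTheory.ExponentialFields.ExponentialRing.exp (kzTuple r t i) = 1) ∧
      Algebra.trdeg ℚ (IntermediateField.adjoin ℚ
        (Set.range (kzTuple r t) ∪ Set.range (Literature.ModelTheory.ExponentialFields.ExponentialRing.exp ∘ kzTuple r t))) ≤ 2 ∧
      ¬ Literature.ModelTheory.ExponentialFields.SchanuelProperty F) ∧
  (Literature.ModelTheory.ExponentialFields.SchanuelProperty ℂ →
    (∃ (M : Type) (_ : Field M) (_ : CharZero M) (_ : Literature.ModelTheory.ExponentialFields.ExponentialRing M),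
      (M ≅[Literature.ModelTheory.ExponentialFields.Language.expRing] ℂ) ∧ Literature.ModelTheory.ExponentialFields.SchanuelProperty ℂ ∧ ¬ Literature.ModelTheory.ExponentialFields.SchanuelProperty M) ∧
    ¬ ∃ T : Literature.ModelTheory.ExponentialFields.Language.expRing.Theory, ∀ (M : Type) (_ : Field M) (_ : CharZero M)
      (_ : Literature.ModelTheory.ExponentialFields.ExponentialRing M), (M ⊨ T ↔ Literature.ModelTheory.ExponentialFields.SchanuelProperty M)) ∧
  (Literature.NumberTheory.Transcendental.exists_isZilberField_of_aleph0_lt →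
    ¬ ∃ T : Literature.ModelTheory.ExponentialFields.Language.expRing.Theory, ∀ (M : Type) (_ : Field M) (_ : CharZero M)
      (_ : Literature.ModelTheory.ExponentialFields.ExponentialRing M), (M ⊨ T ↔ Literature.ModelTheory.ExponentialFields.SchanuelProperty M))

/-- The catalogue declaration holds (all conjuncts are theorems of this file).
[cite: KirbyZilber2014, §2.1] [cite: Kirby2018Variants, §3 Conjecture 3.3 and the 2018 remark] -/
theorem schanuelPropertyNotFirstOrder_holds : SchanuelPropertyNotFirstOrder := by
  refine ⟨not_strongSchanuelConjecture,
    ⟨ultrapower_elementarilyEquivalent ℂ, not_schanuelProperty_ultrapower_complex⟩, ?_,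
    fun hSC => ⟨schanuelProperty_not_elementary_of_schanuel hSC, not_axiomatisable_of_schanuel hSC⟩,
    not_axiomatisable_of_exists_isZilberField⟩
  intro F _ _ _ r t hr hrt ht ht0
  have hrq := noRatQuadraticRelation_of_transcendental hrt
  exact ⟨linearIndependent_kzTuple hrq ht0, exp_kzTuple hr ht,
    trdeg_kzTuple_le_two hr hrq.ne_zero ht ht0,
    not_schanuelProperty_of_kernelMultiplier hr hrq ht ht0⟩

end Complex

end Literature.Barriers.Schanuel
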